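import Summits.QuantumFields.YangMills.Theorems.LangevinControlUVOSLegsFromFemtoAndGapStubAssemblyPermutations
import HarnessLib

/-!
# Soft OS-assembly toolkit XXIV-b: signed permutations of the axes from permutations and the time reflection

Helper file for stub `stub_hypercubic` of crux `OSLegsFromFemtoAndGap` (stmt-QuantumFields-9367, line
`dlr-collar-transfer`, reshape r3).  Pure group theory on the `⁰𝒮`-invariance class of a one-field family `S₁`
under the diagonal action `linActMulti R` of linear isometries `R` of `ℝ⁴`:
* the class of `R` with `S₁ n (linActMulti R F) = S₁ n F` for all off-diagonal `F` is closed under composition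
  and inverses (`linActMulti_trans'`, `IsOffDiagonal.linActMulti`);
* the reflection of the axis `i` is `P_{(0 i)} ∘ θ ∘ P_{(0 i)}` (`exists_axisFlip_invariant`), so every diagonal
  sign matrix is in the class once the coordinate permutations `coordPerm π` and the time reflection
  `thetaMulti 4` are (`exists_signFlip_invariant`);
* a linear isometry `R` with `R eᵢ = ±e_{σ i}` for all `i` is `D⁻¹ ∘ P_σ` for the sign matrix `D` of its signs
  (`σ` is injective, hence a permutation of `Fin 4`; linear maps agree once they agree on the basis), whence
  **`invariant_linActMulti_of_signedPerm`**.
-/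

noncomputable section

open scoped SchwartzMap
open Literature.MathematicalPhysics.QuantumFieldTheory Literature.MathematicalPhysics.QuantumLattice
open Literature.MathematicalPhysics.AQFT

namespace Summit.QuantumFields.YangMills.Theorems.OSLegsFromFemtoAndGap

/-! ### Composition of diagonal actions -/

section General

variable {E : Type*} [NormedAddCommGroup E] [NormedSpace ℝ E] {n : ℕ}

/-- `linActMulti` of a composition: `(R ≫ R') · F = R' · (R · F)`. -/
theorem linActMulti_trans' (R R' : E ≃ₗᵢ[ℝ] E) (F : 𝓢((Fin n → E), ℂ)) :
    linActMulti (R.trans R') F = linActMulti R' (linActMulti R F) := by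
  ext x
  rfl

/-- `linActMulti` of the identity. -/
theorem linActMulti_refl' (F : 𝓢((Fin n → E), ℂ)) : linActMulti (LinearIsometryEquiv.refl ℝ E) F = F := by
  ext x
  rfl

end General

/-! ### The invariance class of a one-field family -/

section Euclidean

variable {S₁ : SchwingerFamily (EuclideanSpace ℝ (Fin 4))}

/-- The invariance class is closed under composition. -/
theorem linActInvariant_trans {R R' : EuclideanSpace ℝ (Fin 4) ≃ₗᵢ[ℝ] EuclideanSpace ℝ (Fin 4)}
    (hR : ∀ (n : ℕ) (F : 𝓢((Fin n → EuclideanSpace ℝ (Fin 4)), ℂ)), IsOffDiagonal F →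
      S₁ n (linActMulti R F) = S₁ n F)
    (hR' : ∀ (n : ℕ) (F : 𝓢((Fin n → EuclideanSpace ℝ (Fin 4)), ℂ)), IsOffDiagonal F →
      S₁ n (linActMulti R' F) = S₁ n F)
    (n : ℕ) (F : 𝓢((Fin n → EuclideanSpace ℝ (Fin 4)), ℂ)) (hF : IsOffDiagonal F) :
    S₁ n (linActMulti (R.trans R') F) = S₁ n F := by
  rw [linActMulti_trans', hR' n _ (hF.linActMulti R), hR n F hF]

/-- The invariance class is closed under inverses. -/
theorem linActInvariant_symm {R : EuclideanSpace ℝ (Fin 4) ≃ₗᵢ[ℝ] EuclideanSpace ℝ (Fin 4)}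
    (hR : ∀ (n : ℕ) (F : 𝓢((Fin n → EuclideanSpace ℝ (Fin 4)), ℂ)), IsOffDiagonal F →
      S₁ n (linActMulti R F) = S₁ n F)
    (n : ℕ) (F : 𝓢((Fin n → EuclideanSpace ℝ (Fin 4)), ℂ)) (hF : IsOffDiagonal F) :
    S₁ n (linActMulti R.symm F) = S₁ n F := by
  rw [← hR n _ (hF.linActMulti R.symm), ← linActMulti_trans', LinearIsometryEquiv.symm_trans_self,
    linActMulti_refl']

/-! ### Coordinates of the coordinate permutations and the basis vectors -/

/-- `(P_π v)_k = v_{π⁻¹ k}`. -/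
theorem coordPerm_apply (π : Equiv.Perm (Fin 4)) (v : EuclideanSpace ℝ (Fin 4)) (k : Fin 4) :
    coordPerm π v k = v (π.symm k) := by
  simp [coordPerm, LinearIsometryEquiv.piLpCongrLeft_apply, Equiv.piCongrLeft'_apply]

/-- `P_π eᵢ = e_{π i}`. -/
theorem coordPerm_single (π : Equiv.Perm (Fin 4)) (i : Fin 4) (c : ℝ) :
    coordPerm π (EuclideanSpace.single i c) = EuclideanSpace.single (π i) c := by
  simp [coordPerm, EuclideanSpace.single, LinearIsometryEquiv.piLpCongrLeft_single]

/-- Two linear isometries of `ℝ⁴` agreeing on the standard basis are equal. -/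
theorem linearIsometryEquiv_eq_of_single {R R' : EuclideanSpace ℝ (Fin 4) ≃ₗᵢ[ℝ] EuclideanSpace ℝ (Fin 4)}
    (h : ∀ i : Fin 4, R (EuclideanSpace.single i 1) = R' (EuclideanSpace.single i 1)) : R = R' := by
  apply LinearIsometryEquiv.toLinearEquiv_injective
  refine (EuclideanSpace.basisFun (Fin 4) ℝ).toBasis.ext' fun i => ?_
  simpa using h i

/-- The standard basis vectors are pairwise distinct. -/
theorem single_injective_index {i j : Fin 4}
    (h : (EuclideanSpace.single i (1 : ℝ) : EuclideanSpace ℝ (Fin 4)) = EuclideanSpace.single j 1) : i = j := by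
  by_contra hij
  have h1 := congrArg (fun v : EuclideanSpace ℝ (Fin 4) => v i) h
  simp [hij] at h1

/-! ### Axis reflections -/

/-- **The reflection of one axis is in the invariance class**: `N_i = P_{(0 i)} ∘ θ ∘ P_{(0 i)}` flips the
`i`-th coordinate, and is invariant once all `P_π` and `Θ` are. -/
theorem exists_axisFlip_invariant
    (hperm : ∀ (π : Equiv.Perm (Fin 4)) (n : ℕ) (F : 𝓢((Fin n → EuclideanSpace ℝ (Fin 4)), ℂ)),
      IsOffDiagonal F → S₁ n (linActMulti (coordPerm π) F) = S₁ n F)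
    (hθ : ∀ (n : ℕ) (F : 𝓢((Fin n → EuclideanSpace ℝ (Fin 4)), ℂ)), IsOffDiagonal F →
      S₁ n (thetaMulti 4 F) = S₁ n F)
    (i : Fin 4) :
    ∃ N : EuclideanSpace ℝ (Fin 4) ≃ₗᵢ[ℝ] EuclideanSpace ℝ (Fin 4),
      (∀ (n : ℕ) (F : 𝓢((Fin n → EuclideanSpace ℝ (Fin 4)), ℂ)), IsOffDiagonal F →
        S₁ n (linActMulti N F) = S₁ n F) ∧
      ∀ (v : EuclideanSpace ℝ (Fin 4)) (k : Fin 4), N v k = if k = i then -v k else v k := by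
  refine ⟨(coordPerm (Equiv.swap 0 i)).trans ((timeReflection 4).trans (coordPerm (Equiv.swap 0 i))),
    linActInvariant_trans (hperm _) (linActInvariant_trans (fun n F hF => hθ n F hF) (hperm _)), fun v k => ?_⟩
  simp only [LinearIsometryEquiv.trans_apply, coordPerm_apply, timeReflection_apply, Equiv.symm_swap,
    Equiv.swap_apply_self]
  have hk : (Equiv.swap (0 : Fin 4) i) k = 0 ↔ k = i := by
    rw [Equiv.swap_apply_eq_iff, Equiv.swap_apply_left]
  by_cases hki : k = i
  · rw [if_pos (hk.2 hki), if_pos hki]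
  · rw [if_neg (fun h => hki (hk.1 h)), if_neg hki]

/-- **Every diagonal sign matrix is in the invariance class**: for a set `s` of axes there is an invariant
linear isometry `D` with `(D v)_k = −v_k` for `k ∈ s` and `v_k` otherwise. -/
theorem exists_signFlip_invariant
    (hperm : ∀ (π : Equiv.Perm (Fin 4)) (n : ℕ) (F : 𝓢((Fin n → EuclideanSpace ℝ (Fin 4)), ℂ)),
      IsOffDiagonal F → S₁ n (linActMulti (coordPerm π) F) = S₁ n F)
    (hθ : ∀ (n : ℕ) (F : 𝓢((Fin n → EuclideanSpace ℝ (Fin 4)), ℂ)), IsOffDiagonal F →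
      S₁ n (thetaMulti 4 F) = S₁ n F)
    (s : Finset (Fin 4)) :
    ∃ D : EuclideanSpace ℝ (Fin 4) ≃ₗᵢ[ℝ] EuclideanSpace ℝ (Fin 4),
      (∀ (n : ℕ) (F : 𝓢((Fin n → EuclideanSpace ℝ (Fin 4)), ℂ)), IsOffDiagonal F →
        S₁ n (linActMulti D F) = S₁ n F) ∧
      ∀ (v : EuclideanSpace ℝ (Fin 4)) (k : Fin 4), D v k = if k ∈ s then -v k else v k := by
  classical
  induction s using Finset.induction_on with
  | empty =>
      exact ⟨LinearIsometryEquiv.refl ℝ _, fun n F _ => by rw [linActMulti_refl'], fun v k => by simp⟩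
  | insert i s his ih =>
      obtain ⟨D, hD, hDv⟩ := ih
      obtain ⟨N, hN, hNv⟩ := exists_axisFlip_invariant hperm hθ i
      refine ⟨D.trans N, linActInvariant_trans hD hN, fun v k => ?_⟩
      rw [LinearIsometryEquiv.trans_apply, hNv, hDv]
      by_cases hki : k = i
      · subst hki
        simp [his]
      · simp [Finset.mem_insert, hki]

end Euclidean

/-! ### Signed permutations -/

/-- **Invariance under signed permutations of the axes.**  If the one-field family `S₁` is invariant on `⁰𝒮`
under every coordinate permutation `P_π` and under the time reflection `Θ`, it is invariant under every linear
isometry `R` of `ℝ⁴` mapping each basis vector to `±` a basis vector: for the sign matrix `D` of the signs of `R`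
(in the class by `exists_signFlip_invariant`), `T = R ∘ D` maps `eᵢ ↦ e_{σ i}` with `σ` injective, hence a
permutation `π`, so `T = P_π` (agreement on the basis) and `R = D⁻¹ ≫ T` is in the class. -/
theorem invariant_linActMulti_of_signedPerm {S₁ : SchwingerFamily (EuclideanSpace ℝ (Fin 4))}
    (hperm : ∀ (π : Equiv.Perm (Fin 4)) (n : ℕ) (F : 𝓢((Fin n → EuclideanSpace ℝ (Fin 4)), ℂ)),
      IsOffDiagonal F → S₁ n (linActMulti (coordPerm π) F) = S₁ n F)
    (hθ : ∀ (n : ℕ) (F : 𝓢((Fin n → EuclideanSpace ℝ (Fin 4)), ℂ)), IsOffDiagonal F →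
      S₁ n (thetaMulti 4 F) = S₁ n F)
    (R : EuclideanSpace ℝ (Fin 4) ≃ₗᵢ[ℝ] EuclideanSpace ℝ (Fin 4))
    (hR : ∀ i : Fin 4, ∃ j : Fin 4, R (EuclideanSpace.single i 1) = EuclideanSpace.single j 1 ∨
      R (EuclideanSpace.single i 1) = -EuclideanSpace.single j 1)
    (n : ℕ) (F : 𝓢((Fin n → EuclideanSpace ℝ (Fin 4)), ℂ)) (hF : IsOffDiagonal F) :
    S₁ n (linActMulti R F) = S₁ n F := by
  classical
  choose σ hσ using hR
  -- the sign matrix of `R`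
  obtain ⟨D, hD, hDv⟩ := exists_signFlip_invariant hperm hθ
    (Finset.univ.filter fun i => R (EuclideanSpace.single i 1) ≠ EuclideanSpace.single (σ i) 1)
  have hDe : ∀ i : Fin 4, D (EuclideanSpace.single i 1) =
      if R (EuclideanSpace.single i 1) ≠ EuclideanSpace.single (σ i) 1 then -EuclideanSpace.single i 1
      else EuclideanSpace.single i 1 := by
    intro i
    ext k
    rw [hDv]
    simp only [Finset.mem_filter, Finset.mem_univ, true_and]
    by_cases hki : k = i
    · subst hki
      split_ifs <;> simp
    · split_ifs <;> simp [hki]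
  -- `T = R ∘ D` is a positive permutation of the basis
  set T : EuclideanSpace ℝ (Fin 4) ≃ₗᵢ[ℝ] EuclideanSpace ℝ (Fin 4) := D.trans R with hT
  have hTe : ∀ i : Fin 4, T (EuclideanSpace.single i 1) = EuclideanSpace.single (σ i) 1 := by
    intro i
    rw [hT, LinearIsometryEquiv.trans_apply, hDe]
    by_cases h : R (EuclideanSpace.single i 1) ≠ EuclideanSpace.single (σ i) 1
    · rw [if_pos h, map_neg]
      rcases hσ i with h' | h'
      · exact absurd h' h
      · rw [h', neg_neg]
    · rw [if_neg h]
      exact not_not.1 h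
  have hσinj : Function.Injective σ := by
    intro i j hij
    have h := hTe i
    rw [hij, ← hTe j] at h
    exact single_injective_index (T.injective h)
  set π : Equiv.Perm (Fin 4) := Equiv.ofBijective σ hσinj.bijective_of_finite with hπ
  have hTπ : T = coordPerm π :=
    linearIsometryEquiv_eq_of_single fun i => by rw [hTe, coordPerm_single, hπ, Equiv.ofBijective_apply]
  -- `R = D⁻¹ ≫ T`
  have hRD : R = D.symm.trans T := by
    ext v : 1
    rw [LinearIsometryEquiv.trans_apply, hT, LinearIsometryEquiv.trans_apply, LinearIsometryEquiv.apply_symm_apply]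
  rw [hRD]
  refine linActInvariant_trans (linActInvariant_symm hD) (fun n F hF => ?_) n F hF
  rw [hTπ]
  exact hperm π n F hF

end Summit.QuantumFields.YangMills.Theorems.OSLegsFromFemtoAndGap

end
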